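/-
Copyright (c) 2026. All rights reserved.
Released under Apache 2.0 license as described in the file LICENSE.
Authors: HodgeCM publication cell (pub-hodgecm2), literature typer `lit-gr91-1` (gen 3).
-/
import Literature.NumberTheory.Weil1964.LocalNormFormLattices
import Literature.NumberTheory.Weil1964.LocalBinaryNormFormIndex
import HarnessLib

/-!
# Weil's fibre integration along the norm of `F(√a)` and the sign of `γ` on the non-trivial norm class

[Weil1964] A. Weil, *Sur certains groupes d'opérateurs unitaires*, Acta Math. 111 (1964), Chap. II n° 28,
proof of Prop. 4, p. 176: for `a ∈ F` not a square, `E = F(√a)`, `N = N_{E/F}`, `H = N(Eˣ)` (a subgroup of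
index `2` of `Fˣ`), Weil integrates a function of `N(z)` over `E` "en intégrant d'abord sur les classes suivant le
groupe compact des `z` tels que `N(z) = 1`": `∫_E Φ(N z) dz = κ ∫_H Φ(t) dt`; applied to `Φ = ψ_b 1_{𝔭^ν}` and
combined with `∫_{𝔭^ν} ψ(bt) dt = 0 = ∫_{H ∩ 𝔭^ν} + ∫_{εH ∩ 𝔭^ν}` (`ε ∉ H`) it gives the SIGN CHANGE of the Weil
index of the binary norm form `b N` when `b` is multiplied by a non-norm `ε` — the `(a, b) = -1` half of
Weil's Hilbert-symbol law (28) `γ(x² - ay² - bz² + abt²) = (a, b)_F`.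

Sequel of `LocalBinaryNormFormIndex.lean` (the `(a, b) = 1` half: norm-class invariance) and
`LocalNormFormLattices.lean` (the norm balls `M_ν = N⁻¹(𝔭^ν)` and `g(bN, M_ν) = g(b) g(-ab)`). Kernel theorems
only (plumbing definitions with bodies; no named fact, no `axiom`, no `sorry`).

## Contents

* §0 algebra of `H = N(E) ∖ 0`: closed under products, inverses, squares; `N(c z) = c² N(z)`; anisotropy.
* §1 the groups `U_k = 1 + 𝔭^k` (`k ≥ 1`): `t U_k = t + 𝔭^{v(t)+k}`; under the LOCAL SQUARE HYPOTHESIS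
  `hsq : ∀ h ∈ 𝔭^{k₀}, IsSquare (1 + h)` (true in every non-archimedean local field; in the tree for the
  completions `K_v` as `QuadraticForms.isSquare_one_add_four_mul`) `H U_k = H` for `k ≥ k₀`.
* §2 THE MODULE OF `E`-MULTIPLICATIONS: `(μ × μ)(N⁻¹(t S)) = ‖t‖ (μ × μ)(N⁻¹ S)` for `t ∈ H`
  (`t = c²`: a homothety; `t = c²(s² - a)`: homothety ∘ `normMul a s`, module `‖s² - a‖` from
  `LocalBinaryNormFormIndex.map_normMul`).
* §3 FIBRE INTEGRATION over finitely many `U_k`-cosets: for `T ⊆ H ∩ 𝔭^ν` compact and `U_k`-saturated,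
  `∫_{N⁻¹ T} ψ(b N z) d(μ × μ) = κ_k ∫_T ψ(bt) dμ` with `κ_k = (μ × μ)(N⁻¹ U_k) / μ(𝔭^k)` (finite subcover by
  the open cosets `t U_k`, on each of which `ψ_b` is constant and both measures scale by `‖t‖`).
* §4 THE SIGN: with `hidx : ∀ t ≠ 0, t ∉ H → ε⁻¹ t ∈ H` (index `≤ 2`; in the tree for `K_v` as
  `index_quadraticNormSubgroup_adicCompletion_eq_two`) and `ε ∉ H`:
  `g(b) g(-ab) = -‖ε‖ · g(εb) g(-aεb)`, hence `γ(εb) γ(-aεb) = -γ(b) γ(-ab)`,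
  `(a, b)_F = -1 ⟹ γ(b) γ(-ab) = -γ(1) γ(-a)`, and the binary form of (28):
  `γ(b) γ(-ab) = (a, b)_F · γ(1) γ(-a)`.
  The proof splits `M_ν = N⁻¹(H ∩ (𝔭^ν ∖ 𝔭^J)) ⊔ M_J` and `𝔭^ν ∖ 𝔭^J = (H ∩ …) ⊔ ε (H ∩ …)`, which gives
  `g(b)g(-ab) + ‖ε‖ g(εb)g(-aεb) = -κ μ(𝔭^J) + (μ×μ)(M_J) + ‖ε‖ (μ×μ)(M_{J-e})` for every large `J`; the right
  side is multiplied by `q⁻²` under `J ↦ J + 2` (homothety by a uniformiser), so both sides vanish.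

## References

* [Weil1964] A. Weil, *Sur certains groupes d'opérateurs unitaires*, Acta Math. 111 (1964) 143–211, Chap. II
  n° 28, pp. 175–177 (Prop. 4 and formula (28)).
-/

set_option autoImplicit false

noncomputable section

open MeasureTheory ValuativeRel Filter Topology Set
open scoped NNReal ENNReal Pointwise
open Literature.NumberTheory.GaloisRepresentations.IsNonarchimedeanLocalField
open Literature.NumberTheory.Automorphic

namespace Literature.NumberTheory.Weil1964

variable {F : Type*} [Field F] [ValuativeRel F] [TopologicalSpace F] [IsNonarchimedeanLocalField F]

/-! ## §0 Algebra of the norm group `H = N(E) ∖ 0` -/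

section Algebra

omit [ValuativeRel F] [TopologicalSpace F] [IsNonarchimedeanLocalField F] in
/-- `N(c z) = c² N(z)`. [cite: Weil1964, Chap. II n° 28, p. 175] -/
theorem normForm_smul (a c : F) (z : F × F) : normForm a (c • z) = c ^ 2 * normForm a z := by
  simp only [normForm_apply, Prod.smul_fst, Prod.smul_snd, smul_eq_mul]
  ring

omit [ValuativeRel F] [TopologicalSpace F] [IsNonarchimedeanLocalField F] in
/-- `0 = N(0)` is a norm. [folklore] -/
private theorem zero_mem_range_normForm (a : F) : (0 : F) ∈ Set.range (normForm a) :=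
  ⟨0, by simp [normForm_apply]⟩

omit [ValuativeRel F] [TopologicalSpace F] [IsNonarchimedeanLocalField F] in
/-- **`N(E)` is closed under multiplication**: `N(z) N(w) = N(z w)` (product in `E = F(√a)`).
[cite: Weil1964, Chap. II n° 28, p. 175] -/
theorem mul_mem_range_normForm {a s t : F} (hs : s ∈ Set.range (normForm a)) (ht : t ∈ Set.range (normForm a)) :
    s * t ∈ Set.range (normForm a) := by
  obtain ⟨z, rfl⟩ := hs
  obtain ⟨w, rfl⟩ := ht
  exact ⟨(z.1 * w.1 + a * z.2 * w.2, z.1 * w.2 + z.2 * w.1), by simp only [normForm_apply]; ring⟩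

omit [ValuativeRel F] [TopologicalSpace F] [IsNonarchimedeanLocalField F] in
/-- `c² N(z) = N(c z)` is a norm. [cite: Weil1964, Chap. II n° 28, p. 175] -/
theorem sq_mul_mem_range_normForm {a t : F} (c : F) (ht : t ∈ Set.range (normForm a)) :
    c ^ 2 * t ∈ Set.range (normForm a) := by
  obtain ⟨z, rfl⟩ := ht
  exact ⟨c • z, normForm_smul a c z⟩

omit [ValuativeRel F] [TopologicalSpace F] [IsNonarchimedeanLocalField F] in
/-- **`N(E)` is closed under inversion**: `N(z)⁻¹ = N(N(z)⁻¹ z̄)`. [cite: Weil1964, Chap. II n° 28, p. 175] -/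
theorem inv_mem_range_normForm {a t : F} (ht : t ∈ Set.range (normForm a)) : t⁻¹ ∈ Set.range (normForm a) := by
  obtain ⟨z, rfl⟩ := ht
  by_cases h0 : normForm a z = 0
  · rw [h0, inv_zero]; exact zero_mem_range_normForm a
  · refine ⟨(normForm a z)⁻¹ • (z.1, -z.2), ?_⟩
    rw [normForm_smul, normForm_apply, normForm_apply, neg_sq]
    field_simp

omit [ValuativeRel F] [TopologicalSpace F] [IsNonarchimedeanLocalField F] in
/-- **anisotropy**: for `a` not a square, `N(z) = 0 ↔ z = 0`. [cite: Weil1964, Chap. II n° 28, p. 175] -/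
theorem normForm_eq_zero_iff {a : F} (ha : ¬ IsSquare a) {z : F × F} : normForm a z = 0 ↔ z = 0 := by
  constructor
  · intro h
    rw [normForm_apply, sub_eq_zero] at h
    by_cases hy : z.2 = 0
    · rw [hy] at h
      have hx : z.1 = 0 := pow_eq_zero_iff two_ne_zero |>.1 (by rw [h]; ring)
      exact Prod.ext hx hy
    · exact absurd ⟨z.1 / z.2, by field_simp; linear_combination -h⟩ ha
  · rintro rfl; simp [normForm_apply]

omit [ValuativeRel F] [TopologicalSpace F] [IsNonarchimedeanLocalField F] in
/-- a non-norm is non-zero. [folklore] -/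
private theorem ne_zero_of_not_mem_range {a ε : F} (hε : ε ∉ Set.range (normForm a)) : ε ≠ 0 :=
  fun h => hε (h ▸ zero_mem_range_normForm a)

omit [ValuativeRel F] [TopologicalSpace F] [IsNonarchimedeanLocalField F] in
/-- `ψ(b x²) ψ(-ab y²) = ψ(b N(x, y))`: the binary form `b ⊕ (-ab)` is `b N`. [cite: Weil1964, Chap. II n° 28, p. 175] -/
theorem psiSq₂_eq_normForm (ψ : AddChar F Circle) (a b : F) (z : F × F) :
    psiSq₂ ψ b (-(a * b)) z = ψ (b * normForm a z) := by
  rw [psiSq₂_apply, normForm_apply, show b * z.1 ^ 2 + -(a * b) * z.2 ^ 2 = b * (z.1 ^ 2 - a * z.2 ^ 2) by ring]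

omit [ValuativeRel F] [TopologicalSpace F] [IsNonarchimedeanLocalField F] in
/-- a norm `b = X² - aY² ≠ 0` solves `a x² + b y² = 1` (so `(a, b)_F = 1`): `a (Y/X)² + b (1/X)² = 1`, or for
`X = 0`, `a ((1 + a⁻¹)/2)² + b ((a⁻¹ - 1)/(2Y))² = 1`. [cite: Weil1964, Chap. II n° 28, p. 177] -/
theorem not_mem_range_normForm_of_hilbertSymbol_eq_neg_one {a b : F} (ha : ¬ IsSquare a) (hb : b ≠ 0)
    (htwo : (2 : F) ≠ 0) (h : QuadraticForms.hilbertSymbol F a b = -1) : b ∉ Set.range (normForm a) := by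
  have ha0 : a ≠ 0 := fun h0 => ha (h0 ▸ IsSquare.zero)
  rintro ⟨z, hz⟩
  rw [normForm_apply] at hz
  apply (QuadraticForms.hilbertSymbol_eq_neg_one_iff a b).1 h
  by_cases hX : z.1 = 0
  · rw [hX] at hz
    have hY : z.2 ≠ 0 := by
      rintro hY; rw [hY] at hz; apply hb; rw [← hz]; ring
    refine ⟨(1 + a⁻¹) / 2, (a⁻¹ - 1) / (2 * z.2), ?_⟩
    rw [← hz]; field_simp; ring
  · refine ⟨z.2 / z.1, 1 / z.1, ?_⟩
    rw [← hz]; field_simp; ring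

end Algebra

/-! ## §1 The groups `U_k = 1 + 𝔭^k` -/

section UnitBall

/-- **`U_k = 1 + 𝔭^k`**, the `k`-th principal unit ball (a subgroup of `𝒪ˣ` for `k ≥ 1`). [cite: Weil1964, Chap. II n° 28, p. 176] -/
def unitBall (k : ℤ) : Set F := (1 : F) +ᵥ primePowBall F k

/-- `u ∈ U_k ↔ u - 1 ∈ 𝔭^k`. [cite: BushnellHenniart2006, §1.1] -/
theorem mem_unitBall_iff {k : ℤ} {u : F} : u ∈ (unitBall k : Set F) ↔ u - 1 ∈ primePowBall F k :=
  mem_vadd_primePowBall_iff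

/-- `1 ∈ U_k`. [cite: BushnellHenniart2006, §1.1] -/
theorem one_mem_unitBall (k : ℤ) : (1 : F) ∈ unitBall k := by
  rw [mem_unitBall_iff, sub_self]; exact zero_mem_primePowBall k

/-- elements of `U_k`, `k ≥ 1`, have absolute value `1` (`U_k ⊆ U_F = 𝒪ˣ`). [cite: BushnellHenniart2006, §1.1] -/
theorem normAbs_of_mem_unitBall {k : ℤ} (hk : 1 ≤ k) {u : F} (hu : u ∈ unitBall k) : normAbs F u = 1 := by
  rw [mem_unitBall_iff, mem_primePowBall_iff] at hu
  have hlt : normAbs F (u - 1) < normAbs F (1 : F) := by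
    rw [map_one]
    refine lt_of_le_of_lt (hu.trans (inv_residueFieldCard_zpow_le_iff.2 hk)) ?_
    rw [zpow_one]; exact inv_residueFieldCard_lt_one
  have := LocalFieldHaar.normAbs_add_eq_of_lt hlt
  rwa [add_sub_cancel, map_one] at this

/-- elements of `U_k`, `k ≥ 1`, are non-zero. [cite: BushnellHenniart2006, §1.1] -/
theorem ne_zero_of_mem_unitBall {k : ℤ} (hk : 1 ≤ k) {u : F} (hu : u ∈ unitBall k) : u ≠ 0 := by
  intro h
  have := normAbs_of_mem_unitBall hk hu
  rw [h, map_zero] at this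
  exact zero_ne_one this

/-- norm-one elements lie in `𝔭^0 = 𝒪`. [folklore] -/
private theorem mem_primePowBall_zero_of_normAbs_eq_one {u : F} (hu : normAbs F u = 1) : u ∈ primePowBall F 0 := by
  rw [mem_primePowBall_iff, hu, zpow_zero]

/-- `U_k` is closed under multiplication (`k ≥ 1`): `uv - 1 = (u-1)v + (v-1)`. [cite: BushnellHenniart2006, §1.1] -/
theorem mul_mem_unitBall {k : ℤ} (hk : 1 ≤ k) {u v : F} (hu : u ∈ unitBall k) (hv : v ∈ unitBall k) :
    u * v ∈ unitBall k := by
  have hv1 := normAbs_of_mem_unitBall hk hv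
  rw [mem_unitBall_iff] at hu hv ⊢
  have h1 : (u - 1) * v ∈ primePowBall F k := by
    simpa using mul_mem_primePowBall hu (mem_primePowBall_zero_of_normAbs_eq_one hv1)
  rw [show u * v - 1 = (u - 1) * v + (v - 1) by ring]
  exact add_mem_primePowBall h1 hv

/-- `U_k` is closed under inversion (`k ≥ 1`): `u⁻¹ - 1 = -(u-1) u⁻¹`. [cite: BushnellHenniart2006, §1.1] -/
theorem inv_mem_unitBall {k : ℤ} (hk : 1 ≤ k) {u : F} (hu : u ∈ unitBall k) : u⁻¹ ∈ unitBall k := by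
  have hu0 := ne_zero_of_mem_unitBall hk hu
  have hu1 := normAbs_of_mem_unitBall hk hu
  rw [mem_unitBall_iff] at hu ⊢
  have h1 : -(u - 1) * u⁻¹ ∈ primePowBall F k := by
    simpa using mul_mem_primePowBall (neg_mem_primePowBall hu)
      (mem_primePowBall_zero_of_normAbs_eq_one (by rw [map_inv₀, hu1, inv_one]))
  rwa [show -(u - 1) * u⁻¹ = u⁻¹ - 1 by field_simp; ring] at h1

/-- `u U_k = U_k` for `u ∈ U_k` (`U_k` is a group). [cite: BushnellHenniart2006, §1.1] -/
theorem smul_unitBall_of_mem {k : ℤ} (hk : 1 ≤ k) {u : F} (hu : u ∈ unitBall k) :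
    u • (unitBall k : Set F) = unitBall k := by
  have hu0 := ne_zero_of_mem_unitBall hk hu
  ext v
  rw [Set.mem_smul_set_iff_inv_smul_mem₀ hu0, smul_eq_mul]
  constructor
  · intro h
    have := mul_mem_unitBall hk hu h
    rwa [mul_inv_cancel_left₀ hu0] at this
  · intro h
    exact mul_mem_unitBall hk (inv_mem_unitBall hk hu) h

/-- **`t U_k = t + 𝔭^{k+j}` for `‖t‖ = q^{-j}`**: multiplicative cosets of `U_k` are additive balls.
[cite: Weil1964, Chap. II n° 28, p. 176] -/
theorem smul_unitBall_eq_vadd {t : F} {j : ℤ} (ht : normAbs F t = (residueFieldCard F : ℝ≥0)⁻¹ ^ j) (k : ℤ) :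
    t • (unitBall k : Set F) = t +ᵥ primePowBall F (k + j) := by
  have ht0 : t ≠ 0 := by
    rintro rfl
    rw [map_zero] at ht
    exact (zpow_pos inv_residueFieldCard_pos j).ne ht
  ext x
  rw [Set.mem_smul_set_iff_inv_smul_mem₀ ht0, smul_eq_mul, mem_unitBall_iff, mem_vadd_primePowBall_iff,
    show x - t = t * (t⁻¹ * x - 1) by rw [mul_sub, mul_inv_cancel_left₀ ht0, mul_one],
    mul_mem_primePowBall_iff ht, add_sub_cancel_right]

/-- two cosets of `U_k` that meet are equal. [cite: BushnellHenniart2006, §1.1] -/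
theorem smul_unitBall_eq_of_mem {k : ℤ} (hk : 1 ≤ k) {t x : F} (hx : x ∈ t • (unitBall k : Set F)) :
    x • (unitBall k : Set F) = t • unitBall k := by
  obtain ⟨u, hu, rfl⟩ := Set.mem_smul_set.1 hx
  rw [smul_eq_mul, ← smul_smul, smul_unitBall_of_mem hk hu]

/-- under the local square hypothesis `1 + 𝔭^{k₀} ⊆ F²`, the elements of `U_k`, `k ≥ k₀`, are squares. [cite: Weil1964, Chap. II n° 28, p. 176] -/
theorem isSquare_of_mem_unitBall {k₀ k : ℤ} (hsq : ∀ h ∈ primePowBall F k₀, IsSquare (1 + h)) (hk : k₀ ≤ k)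
    {u : F} (hu : u ∈ unitBall k) : IsSquare u := by
  have := hsq (u - 1) (primePowBall_antitone hk (mem_unitBall_iff.1 hu))
  rwa [add_sub_cancel] at this

/-- **`H U_k = H`** (`k ≥ k₀`): `t u = r² t` is a norm with `t`. [cite: Weil1964, Chap. II n° 28, p. 176] -/
theorem mul_mem_range_normForm_of_mem_unitBall {a : F} {k₀ k : ℤ} (hsq : ∀ h ∈ primePowBall F k₀, IsSquare (1 + h))
    (hk : k₀ ≤ k) {t u : F} (ht : t ∈ Set.range (normForm a)) (hu : u ∈ unitBall k) :
    t * u ∈ Set.range (normForm a) := by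
  obtain ⟨r, hr⟩ := isSquare_of_mem_unitBall hsq hk hu
  rw [hr, show t * (r * r) = r ^ 2 * t by ring]
  exact sq_mul_mem_range_normForm r ht

/-- **finite decomposition into `U_k`-cosets**: a compact `U_k`-saturated `T ⊆ F ∖ 0` is a finite disjoint union of
cosets `t U_k`, `t ∈ T` (a finite subcover by open cosets; cosets that meet coincide). [folklore] -/
private theorem exists_finset_cosets₁ {k : ℤ} (hk : 1 ≤ k) {T : Set F} (hT : IsCompact T) (hT0 : (0 : F) ∉ T)
    (hsat : ∀ t ∈ T, ∀ u ∈ unitBall k, t * u ∈ T) :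
    ∃ C : Finset (Set F), (∀ B ∈ C, ∃ c ∈ T, B = c • (unitBall k : Set F)) ∧
      (↑C : Set (Set F)).PairwiseDisjoint (fun B => B) ∧ T = ⋃ B ∈ C, B := by
  classical
  have hopen : ∀ c ∈ T, IsOpen (c • (unitBall k : Set F)) := by
    intro c hc
    have hc0 : c ≠ 0 := fun h => hT0 (h ▸ hc)
    obtain ⟨j, hj⟩ := exists_normAbs_eq_inv_zpow hc0
    rw [smul_unitBall_eq_vadd hj]
    exact isOpen_vadd_primePowBall _ _
  obtain ⟨A, hAT, hAfin, hA⟩ := hT.elim_finite_subcover_image (b := T) (c := fun c : F => c • (unitBall k : Set F)) hopen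
    (fun t ht => Set.mem_iUnion₂.2 ⟨t, ht, Set.mem_smul_set.2 ⟨1, one_mem_unitBall k, by rw [smul_eq_mul, mul_one]⟩⟩)
  obtain ⟨A', hA'⟩ := hAfin.exists_finset_coe
  subst hA'
  refine ⟨A'.image fun c => c • (unitBall k : Set F), ?_, ?_, ?_⟩
  · intro B hB
    obtain ⟨c, hc, rfl⟩ := Finset.mem_image.1 hB
    exact ⟨c, hAT (Finset.mem_coe.2 hc), rfl⟩
  · intro B hB B' hB' hne
    obtain ⟨c, -, rfl⟩ := Finset.mem_image.1 (Finset.mem_coe.1 hB)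
    obtain ⟨c', -, rfl⟩ := Finset.mem_image.1 (Finset.mem_coe.1 hB')
    rw [Function.onFun, Set.disjoint_left]
    intro x hx hx'
    exact hne ((smul_unitBall_eq_of_mem hk hx).symm.trans (smul_unitBall_eq_of_mem hk hx'))
  · apply Set.Subset.antisymm
    · intro x hx
      obtain ⟨c, hc, hxc⟩ := Set.mem_iUnion₂.1 (hA hx)
      exact Set.mem_iUnion₂.2 ⟨c • (unitBall k : Set F), Finset.mem_image.2 ⟨c, Finset.mem_coe.1 hc, rfl⟩, hxc⟩
    · intro x hx
      obtain ⟨B, hB, hxB⟩ := Set.mem_iUnion₂.1 hx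
      obtain ⟨c, hc, rfl⟩ := Finset.mem_image.1 hB
      obtain ⟨u, hu, rfl⟩ := Set.mem_smul_set.1 hxB
      exact hsat c (hAT (Finset.mem_coe.2 hc)) u hu

end UnitBall

/-! ## §2 The module of `E`-multiplications: `(μ × μ)(N⁻¹(t S)) = ‖t‖ (μ × μ)(N⁻¹ S)` for `t ∈ H` -/

section Module

/-- `F` is second countable (instance helper). [folklore] -/
private theorem secondCountable'' : SecondCountableTopology F := secondCountableTopology_localField F

/-- `F` is Hausdorff (instance helper). [folklore] -/
private theorem t2'' : T2Space F :=
  (Literature.NumberTheory.GaloisRepresentations.IsNonarchimedeanLocalField.isLocalField F).toT2Space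

variable [MeasurableSpace F] [BorelSpace F] (μ : Measure F) [μ.IsAddHaarMeasure]

omit [BorelSpace F] in
/-- a Haar measure on `F` is `σ`-finite (instance helper). [folklore] -/
private theorem sigmaFinite'' : SigmaFinite μ := by
  haveI : T2Space F := t2''
  haveI : LocallyCompactSpace F :=
    (Literature.NumberTheory.GaloisRepresentations.IsNonarchimedeanLocalField.isLocalField F).toLocallyCompactSpace
  haveI : SecondCountableTopology F := secondCountable''
  infer_instance

/-- the homothety `z ↦ c z` of `F × F` multiplies `μ × μ` by `‖c‖⁻² = ‖c²‖⁻¹`. [folklore] -/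
private theorem map_smul_prod {c : F} (hc : c ≠ 0) :
    Measure.map (fun z : F × F => c • z) (μ.prod μ) = ((normAbs F (c ^ 2)⁻¹ : ℝ≥0) : ℝ≥0∞) • μ.prod μ := by
  haveI : SecondCountableTopology F := secondCountable''
  haveI := sigmaFinite'' μ
  have e : (fun z : F × F => c • z) = Prod.map (fun x => c * x) (fun x => c * x) := rfl
  rw [e, ← Measure.map_prod_map μ μ (measurable_const_mul c) (measurable_const_mul c), map_mul_left_addHaar μ hc,
    Measure.prod_smul_left, Measure.prod_smul_right, smul_smul, ← ENNReal.coe_mul, ← map_mul, ← mul_inv, ← pow_two]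

/-- **homotheties**: `(μ × μ)(N⁻¹(c² S)) = ‖c²‖ (μ × μ)(N⁻¹ S)` (`N(c z) = c² N(z)`).
[cite: Weil1964, Chap. II n° 28, p. 176] -/
theorem measure_preimage_normForm_sq_smul (a : F) {c : F} (hc : c ≠ 0) {S : Set F} (hS : MeasurableSet S) :
    (μ.prod μ) (normForm a ⁻¹' (c ^ 2 • S)) = (normAbs F (c ^ 2) : ℝ≥0∞) * (μ.prod μ) (normForm a ⁻¹' S) := by
  haveI : SecondCountableTopology F := secondCountable''
  haveI := sigmaFinite'' μ
  have hc2 : c ^ 2 ≠ 0 := pow_ne_zero 2 hc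
  have hmeas : Measurable (fun z : F × F => c • z) :=
    show Measurable (Prod.map (fun x => c * x) (fun x => c * x)) from
      (measurable_const_mul c).prodMap (measurable_const_mul c)
  have hN : Measurable (normForm a) := (continuous_normForm a).measurable
  have hpre : (fun z : F × F => c • z) ⁻¹' (normForm a ⁻¹' (c ^ 2 • S)) = normForm a ⁻¹' S := by
    ext z
    simp only [Set.mem_preimage, normForm_smul]
    exact Set.smul_mem_smul_set_iff₀ hc2 S (normForm a z)
  have h := Measure.map_apply (μ := μ.prod μ) hmeas (hN (hS.const_smul_of_ne_zero hc2))
  rw [map_smul_prod μ hc, Measure.smul_apply, hpre, smul_eq_mul] at h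
  have hne : (normAbs F (c ^ 2) : ℝ≥0) ≠ 0 := (map_ne_zero _).2 hc2
  rw [← h, ← mul_assoc, map_inv₀, ENNReal.coe_inv hne, ENNReal.mul_inv_cancel (ENNReal.coe_ne_zero.2 hne)
    ENNReal.coe_ne_top, one_mul]

/-- **multiplication by `s + √a`**: `(μ × μ)(N⁻¹((s² - a) S)) = ‖s² - a‖ (μ × μ)(N⁻¹ S)`.
[cite: Weil1964, Chap. II n° 28, p. 176] -/
theorem measure_preimage_normForm_norm_smul (a : F) {s : F} (hc : s ^ 2 - a ≠ 0) {S : Set F} (hS : MeasurableSet S) :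
    (μ.prod μ) (normForm a ⁻¹' ((s ^ 2 - a) • S)) = (normAbs F (s ^ 2 - a) : ℝ≥0∞) * (μ.prod μ) (normForm a ⁻¹' S) := by
  haveI : SecondCountableTopology F := secondCountable''
  haveI := sigmaFinite'' μ
  have hmeas : Measurable (normMul a s) := (continuous_normMul a s).measurable
  have hN : Measurable (normForm a) := (continuous_normForm a).measurable
  have hpre : normMul a s ⁻¹' (normForm a ⁻¹' ((s ^ 2 - a) • S)) = normForm a ⁻¹' S := by
    ext z
    simp only [Set.mem_preimage]
    rw [normForm_apply, norm_normMul, ← normForm_apply]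
    exact Set.smul_mem_smul_set_iff₀ hc S (normForm a z)
  have h := Measure.map_apply (μ := μ.prod μ) hmeas (hN (hS.const_smul_of_ne_zero hc))
  rw [map_normMul μ a s hc, Measure.smul_apply, hpre, smul_eq_mul] at h
  have hne : (normAbs F (s ^ 2 - a) : ℝ≥0) ≠ 0 := (map_ne_zero _).2 hc
  rw [← h, ← mul_assoc, map_inv₀, ENNReal.coe_inv hne, ENNReal.mul_inv_cancel (ENNReal.coe_ne_zero.2 hne)
    ENNReal.coe_ne_top, one_mul]

/-- **THE MODULE OF `E`-MULTIPLICATIONS**: `(μ × μ)(N⁻¹(t S)) = ‖t‖ (μ × μ)(N⁻¹ S)` for `t ∈ H = N(E) ∖ 0`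
(`t = x²` or `t = y²((x/y)² - a)`; the measure `N_*(μ × μ)|_H` is `‖t‖`-homogeneous, i.e. a multiple of `dt|_H`).
[cite: Weil1964, Chap. II n° 28, p. 176] -/
theorem measure_preimage_normForm_smul {a : F} (ha : ¬ IsSquare a) {t : F} (ht : t ∈ Set.range (normForm a))
    (ht0 : t ≠ 0) {S : Set F} (hS : MeasurableSet S) :
    (μ.prod μ) (normForm a ⁻¹' (t • S)) = (normAbs F t : ℝ≥0∞) * (μ.prod μ) (normForm a ⁻¹' S) := by
  haveI : SecondCountableTopology F := secondCountable''
  obtain ⟨z, rfl⟩ := ht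
  by_cases hy : z.2 = 0
  · have e : normForm a z = z.1 ^ 2 := by rw [normForm_apply, hy]; ring
    have hx : z.1 ≠ 0 := fun h => ht0 (by rw [e, h]; ring)
    rw [e]
    exact measure_preimage_normForm_sq_smul μ a hx hS
  · set s : F := z.1 / z.2 with hsdef
    have hc : s ^ 2 - a ≠ 0 := fun h => ha ⟨s, by linear_combination -h⟩
    have e : normForm a z = z.2 ^ 2 * (s ^ 2 - a) := by rw [normForm_apply, hsdef]; field_simp
    rw [e, ← smul_smul, measure_preimage_normForm_sq_smul μ a hy (hS.const_smul_of_ne_zero hc),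
      measure_preimage_normForm_norm_smul μ a hc hS, ← mul_assoc, map_mul, ENNReal.coe_mul]

/-- real-valued form of the module formula. [cite: Weil1964, Chap. II n° 28, p. 176] -/
theorem measureReal_preimage_normForm_smul {a : F} (ha : ¬ IsSquare a) {t : F} (ht : t ∈ Set.range (normForm a))
    (ht0 : t ≠ 0) {S : Set F} (hS : MeasurableSet S) :
    (μ.prod μ).real (normForm a ⁻¹' (t • S)) = (normAbs F t : ℝ) * (μ.prod μ).real (normForm a ⁻¹' S) := by
  rw [measureReal_def, measure_preimage_normForm_smul μ ha ht ht0 hS, ENNReal.toReal_mul, ENNReal.coe_toReal,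
    measureReal_def]

end Module

/-- membership in a norm ball, in terms of `normForm`. [cite: Weil1964, Chap. II n° 28, p. 175] -/
theorem mem_normBall {a : F} {ν : ℤ} {z : F × F} : z ∈ normBall a ν ↔ normForm a z ∈ primePowBall F ν := Iff.rfl

/-! ## §3 Fibre integration over finitely many `U_k`-cosets -/

section Fibre

variable [MeasurableSpace F] [BorelSpace F] (μ : Measure F) [μ.IsAddHaarMeasure] {ψ : AddChar F Circle}

/-- **Weil's constant `κ_k = (μ × μ)(N⁻¹(1 + 𝔭^k)) / μ(𝔭^k)`** relating `dz` on `E` to `dt` on `H` along `N`.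
[cite: Weil1964, Chap. II n° 28, p. 176] -/
def fibreConst (a : F) (k : ℤ) : ℝ := (μ.prod μ).real (normForm a ⁻¹' unitBall k) / μ.real (primePowBall F k)

omit [BorelSpace F] [μ.IsAddHaarMeasure] in
/-- unfolding `κ_k`. [cite: Weil1964, Chap. II n° 28, p. 176] -/
theorem fibreConst_def (a : F) (k : ℤ) :
    fibreConst μ a k = (μ.prod μ).real (normForm a ⁻¹' unitBall k) / μ.real (primePowBall F k) := rfl

omit [μ.IsAddHaarMeasure] in
/-- `ψ(f)` is integrable on every set of finite product measure. [folklore] -/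
private theorem integrableOn_psiSq₂' (hψ : Continuous ψ) (b₁ b₂ : F) {D : Set (F × F)} (hD : (μ.prod μ) D ≠ ∞) :
    IntegrableOn (psiSq₂ ψ b₁ b₂) D (μ.prod μ) := by
  haveI : SecondCountableTopology F := secondCountable''
  exact Measure.integrableOn_of_bounded (M := 1) hD
    (((continuous_psiSq hψ b₁).comp continuous_fst).mul
      ((continuous_psiSq hψ b₂).comp continuous_snd)).aestronglyMeasurable
    (Eventually.of_forall fun z => by rw [psiSq₂, norm_mul, norm_psiSq, norm_psiSq, one_mul])

omit [μ.IsAddHaarMeasure] in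
/-- `t ↦ ψ(bt)` is integrable on every set of finite measure. [folklore] -/
private theorem integrableOn_addChar_mul (hψ : Continuous ψ) (b : F) {S : Set F} (hS : μ S ≠ ∞) :
    IntegrableOn (fun t => ((ψ (b * t) : Circle) : ℂ)) S μ := by
  haveI : SecondCountableTopology F := secondCountable''
  exact Measure.integrableOn_of_bounded (M := 1) hS
    (continuous_subtype_val.comp (hψ.comp (continuous_const.mul continuous_id))).aestronglyMeasurable
    (Eventually.of_forall fun t => (Circle.norm_coe _).le)

omit [MeasurableSpace F] [BorelSpace F] in
/-- `ψ(bt) = ψ(bc)` on `c + 𝔭^m` as soon as `v_b + m ≥ d` (`ψ` has level `d`). [folklore] -/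
private theorem addChar_mul_eq_of_mem_vadd {d vb m : ℤ} {b c t : F} (hd : ψ.HasConductorExp d)
    (hb : normAbs F b = (residueFieldCard F : ℝ≥0)⁻¹ ^ vb) (hm : d ≤ vb + m) (ht : t ∈ c +ᵥ primePowBall F m) :
    ((ψ (b * t) : Circle) : ℂ) = ψ (b * c) := by
  rw [mem_vadd_primePowBall_iff] at ht
  have hbm : b ∈ primePowBall F vb := by rw [mem_primePowBall_iff, hb]
  have h1 : b * (t - c) ∈ primePowBall F d := primePowBall_antitone hm (mul_mem_primePowBall hbm ht)
  have h2 : ψ (b * (t - c)) = 1 := hd.1 _ h1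
  rw [show b * t = b * c + b * (t - c) by ring, AddChar.map_add_eq_mul, h2, mul_one]

/-- **FIBRE INTEGRATION** (finite form): for `T ⊆ H ∩ 𝔭^ν` compact, `0 ∉ T`, `T U_k = T` (`k ≥ 1`), and
`d ≤ ν + k + v_b` (so that `ψ_b` is constant on the cosets `t U_k = t + 𝔭^{v(t)+k}`, `t ∈ T`):
`∫_{N⁻¹ T} ψ(b N z) d(μ × μ) = κ_k ∫_T ψ(bt) dt` — "intégrant d'abord sur les classes suivant le groupe compact
des `z` tels que `N(z) ∈ U_k`, puis sur le quotient" (finitely many cosets; both sides scale by `‖t‖` on `t U_k`).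
[cite: Weil1964, Chap. II n° 28, p. 176] -/
theorem setIntegral_preimage_normForm_eq_fibreConst_mul {a b : F} (ha : ¬ IsSquare a) {d vb k ν : ℤ}
    (hd : ψ.HasConductorExp d) (hb : normAbs F b = (residueFieldCard F : ℝ≥0)⁻¹ ^ vb) (hk : 1 ≤ k)
    (hν : d ≤ ν + k + vb) {T : Set F} (hTc : IsCompact T) (hT0 : (0 : F) ∉ T)
    (hTN : T ⊆ Set.range (normForm a)) (hTν : T ⊆ primePowBall F ν)
    (hsat : ∀ t ∈ T, ∀ u ∈ unitBall k, t * u ∈ T) :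
    ∫ z in normForm a ⁻¹' T, psiSq₂ ψ b (-(a * b)) z ∂(μ.prod μ) =
      (fibreConst μ a k : ℂ) * ∫ t in T, ((ψ (b * t) : Circle) : ℂ) ∂μ := by
  haveI : SecondCountableTopology F := secondCountable''
  haveI : T2Space F := t2''
  haveI := sigmaFinite'' μ
  classical
  obtain ⟨C, hC, hCdisj, hTC⟩ := exists_finset_cosets₁ hk hTc hT0 hsat
  have hψc : Continuous ψ := continuous_of_hasConductorExp hd
  have hN : Measurable (normForm a) := (continuous_normForm a).measurable
  have hUmeas : MeasurableSet (unitBall k : Set F) := measurableSet_vadd_primePowBall _ _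
  have hμU : μ.real (unitBall k : Set F) = μ.real (primePowBall F k) := by
    rw [measureReal_def, measureReal_def, unitBall, measure_vadd]
  have hP0 : μ.real (primePowBall F k) ≠ 0 := (LocalFieldHaar.measureReal_primePowBall_pos μ k).ne'
  -- finiteness of the product measure of `N⁻¹ T ⊆ M_ν`
  have hfin : (μ.prod μ) (normForm a ⁻¹' T) ≠ ∞ :=
    (measure_mono (fun z hz => mem_normBall.2 (hTν hz))).trans_lt
      ((isCompact_normBall ha ν).measure_lt_top) |>.ne
  have hTfin : μ T ≠ ∞ := hTc.measure_lt_top.ne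
  -- the coset-wise identity
  have hterm : ∀ B ∈ C, MeasurableSet B ∧ B ⊆ T ∧
      ∫ z in normForm a ⁻¹' B, psiSq₂ ψ b (-(a * b)) z ∂(μ.prod μ) =
        (fibreConst μ a k : ℂ) * ∫ t in B, ((ψ (b * t) : Circle) : ℂ) ∂μ := by
    intro B hB
    obtain ⟨c, hcT, rfl⟩ := hC B hB
    have hc0 : c ≠ 0 := fun h => hT0 (h ▸ hcT)
    obtain ⟨j, hj⟩ := exists_normAbs_eq_inv_zpow hc0
    have hνj : ν ≤ j := by
      have := hTν hcT
      rw [mem_primePowBall_iff, hj, inv_residueFieldCard_zpow_le_iff] at this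
      exact this
    have hBeq : c • (unitBall k : Set F) = c +ᵥ primePowBall F (k + j) := smul_unitBall_eq_vadd hj k
    have hBT : c • (unitBall k : Set F) ⊆ T := by
      intro x hx
      obtain ⟨u, hu, rfl⟩ := Set.mem_smul_set.1 hx
      exact hsat c hcT u hu
    have hmeasB : MeasurableSet (c • (unitBall k : Set F)) := by rw [hBeq]; exact measurableSet_vadd_primePowBall _ _
    have hmeasNB : MeasurableSet (normForm a ⁻¹' (c • (unitBall k : Set F))) := hN hmeasB
    have hconst : ∀ t ∈ c • (unitBall k : Set F), ((ψ (b * t) : Circle) : ℂ) = ψ (b * c) := by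
      intro t ht
      rw [hBeq] at ht
      exact addChar_mul_eq_of_mem_vadd hd hb (by omega) ht
    refine ⟨hmeasB, hBT, ?_⟩
    -- left side on the coset
    have hL : ∫ z in normForm a ⁻¹' (c • (unitBall k : Set F)), psiSq₂ ψ b (-(a * b)) z ∂(μ.prod μ) =
        (((normAbs F c : ℝ) * (μ.prod μ).real (normForm a ⁻¹' unitBall k) : ℝ) : ℂ) * ψ (b * c) := by
      rw [setIntegral_congr_fun hmeasNB (fun z hz => by rw [psiSq₂_eq_normForm, hconst _ hz]), setIntegral_const,
        Complex.real_smul, measureReal_preimage_normForm_smul μ ha (hTN hcT) hc0 hUmeas]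
    -- right side on the coset
    have hR : ∫ t in c • (unitBall k : Set F), ((ψ (b * t) : Circle) : ℂ) ∂μ =
        (((normAbs F c : ℝ) * μ.real (primePowBall F k) : ℝ) : ℂ) * ψ (b * c) := by
      rw [setIntegral_congr_fun hmeasB (fun t ht => hconst t ht), setIntegral_const, Complex.real_smul, ← hμU,
        measureReal_def, measureReal_def, addHaar_smul_set μ hc0, ENNReal.toReal_mul, ENNReal.coe_toReal]
    rw [hL, hR, ← mul_assoc, ← Complex.ofReal_mul, fibreConst_def, div_mul_eq_mul_div, mul_left_comm, mul_div_assoc,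
      mul_div_cancel_right₀ _ hP0]
  -- sum over the cosets
  have hpre : normForm a ⁻¹' T = ⋃ B ∈ C, normForm a ⁻¹' B := by
    rw [hTC, Set.preimage_iUnion₂]
  have hdisj' : (↑C : Set (Set F)).Pairwise (Function.onFun Disjoint fun B => normForm a ⁻¹' B) := by
    intro B hB B' hB' hne
    exact (hCdisj hB hB' hne).preimage (normForm a)
  rw [hpre, integral_biUnion_finset C (fun B hB => hN (hterm B hB).1) hdisj'
      (fun B hB => (integrableOn_psiSq₂' μ hψc b (-(a * b)) hfin).mono_set (by
        rw [hpre]; exact Set.subset_biUnion_of_mem hB)),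
    show (∫ t in T, ((ψ (b * t) : Circle) : ℂ) ∂μ) = ∫ t in ⋃ B ∈ C, B, ((ψ (b * t) : Circle) : ℂ) ∂μ by rw [← hTC],
    integral_biUnion_finset C (fun B hB => (hterm B hB).1) hCdisj
      (fun B hB => (integrableOn_addChar_mul μ hψc b hTfin).mono_set (hterm B hB).2.1),
    Finset.mul_sum]
  exact Finset.sum_congr rfl fun B hB => (hterm B hB).2.2

end Fibre

/-! ## §4 The two norm classes in an annulus -/

section Annulus

/-- **the norm class in an annulus** `H_{ν,J} = N(E) ∩ (𝔭^ν ∖ 𝔭^J)`. [cite: Weil1964, Chap. II n° 28, p. 176] -/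
def normAnnulus (a : F) (ν J : ℤ) : Set F := Set.range (normForm a) ∩ (primePowBall F ν \ primePowBall F J)

/-- membership in `H_{ν,J}`. [cite: Weil1964, Chap. II n° 28, p. 176] -/
theorem mem_normAnnulus_iff {a : F} {ν J : ℤ} {t : F} :
    t ∈ normAnnulus a ν J ↔ t ∈ Set.range (normForm a) ∧ t ∈ primePowBall F ν ∧ t ∉ primePowBall F J := by
  simp only [normAnnulus, Set.mem_inter_iff, Set.mem_sdiff]

/-- `0 ∉ H_{ν,J}`. [cite: Weil1964, Chap. II n° 28, p. 176] -/
theorem zero_not_mem_normAnnulus (a : F) (ν J : ℤ) : (0 : F) ∉ normAnnulus a ν J :=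
  fun h => (mem_normAnnulus_iff.1 h).2.2 (zero_mem_primePowBall J)

/-- `H_{ν,J} ⊆ N(E)`. [cite: Weil1964, Chap. II n° 28, p. 176] -/
theorem normAnnulus_subset_range (a : F) (ν J : ℤ) : normAnnulus a ν J ⊆ Set.range (normForm a) :=
  Set.inter_subset_left

/-- `H_{ν,J} ⊆ 𝔭^ν`. [cite: Weil1964, Chap. II n° 28, p. 176] -/
theorem normAnnulus_subset_primePowBall (a : F) (ν J : ℤ) : normAnnulus a ν J ⊆ primePowBall F ν :=
  fun _ h => h.2.1

/-- `N(E) ∩ 𝔭^ν = N(M_ν)`. [cite: Weil1964, Chap. II n° 28, p. 175] -/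
theorem range_normForm_inter_primePowBall (a : F) (ν : ℤ) :
    Set.range (normForm a) ∩ primePowBall F ν = normForm a '' normBall a ν := by
  ext t
  constructor
  · rintro ⟨⟨z, rfl⟩, ht⟩; exact ⟨z, mem_normBall.2 ht, rfl⟩
  · rintro ⟨z, hz, rfl⟩; exact ⟨⟨z, rfl⟩, mem_normBall.1 hz⟩

/-- the norm class in an annulus is compact (`N(M_ν)` minus an open ball). [cite: Weil1964, Chap. II n° 28, p. 176] -/
theorem isCompact_normAnnulus {a : F} (ha : ¬ IsSquare a) (ν J : ℤ) : IsCompact (normAnnulus a ν J) := by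
  have e : normAnnulus a ν J = (Set.range (normForm a) ∩ primePowBall F ν) ∩ (primePowBall F J)ᶜ := by
    rw [normAnnulus, Set.sdiff_eq, Set.inter_assoc]
  rw [e, range_normForm_inter_primePowBall]
  exact ((isCompact_normBall ha ν).image (continuous_normForm a)).inter_right (isOpen_primePowBall J).isClosed_compl

/-- `N⁻¹(H_{ν,J}) = M_ν ∖ M_J`. [cite: Weil1964, Chap. II n° 28, p. 176] -/
theorem preimage_normAnnulus (a : F) (ν J : ℤ) : normForm a ⁻¹' normAnnulus a ν J = normBall a ν \ normBall a J := by
  ext z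
  simp only [Set.mem_preimage, mem_normAnnulus_iff, Set.mem_sdiff, mem_normBall]
  exact ⟨fun h => ⟨h.2.1, h.2.2⟩, fun h => ⟨⟨z, rfl⟩, h.1, h.2⟩⟩

/-- `H_{ν,J} U_k = H_{ν,J}` for `k ≥ max(k₀, 1)`. [cite: Weil1964, Chap. II n° 28, p. 176] -/
theorem mul_mem_normAnnulus {a : F} {k₀ k ν J : ℤ} (hsq : ∀ h ∈ primePowBall F k₀, IsSquare (1 + h)) (hk₀ : k₀ ≤ k)
    (hk : 1 ≤ k) {t u : F} (ht : t ∈ normAnnulus a ν J) (hu : u ∈ unitBall k) : t * u ∈ normAnnulus a ν J := by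
  rw [mem_normAnnulus_iff] at ht ⊢
  have hu1 := normAbs_of_mem_unitBall hk hu
  refine ⟨mul_mem_range_normForm_of_mem_unitBall hsq hk₀ ht.1 hu, ?_, fun h => ht.2.2 ?_⟩
  · rw [mem_primePowBall_iff, map_mul, hu1, mul_one]; exact ht.2.1
  · rwa [mem_primePowBall_iff, map_mul, hu1, mul_one] at h

/-- **`𝔭^ν ∖ 𝔭^J = H_{ν,J} ∪ ε H_{ν-e,J-e}`** when `‖ε‖ = q^{-e}` and every non-norm is `ε` times a norm
(`[Fˣ : H] ≤ 2`). [cite: Weil1964, Chap. II n° 28, p. 176] -/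
theorem primePowBall_diff_eq_union {a ε : F} {e : ℤ} (hεe : normAbs F ε = (residueFieldCard F : ℝ≥0)⁻¹ ^ e)
    (hidx : ∀ t : F, t ≠ 0 → t ∉ Set.range (normForm a) → ε⁻¹ * t ∈ Set.range (normForm a)) (ν J : ℤ) :
    primePowBall F ν \ primePowBall F J = normAnnulus a ν J ∪ ε • normAnnulus a (ν - e) (J - e) := by
  have hε0 : ε ≠ 0 := by
    rintro rfl
    rw [map_zero] at hεe
    exact (zpow_pos inv_residueFieldCard_pos e).ne hεe
  have conv : ∀ (m : ℤ) (t : F), ε⁻¹ * t ∈ primePowBall F (m - e) ↔ t ∈ primePowBall F m := fun m t => by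
    rw [← mul_mem_primePowBall_iff hεe, mul_inv_cancel_left₀ hε0]
  ext t
  rw [Set.mem_union, Set.mem_smul_set_iff_inv_smul_mem₀ hε0, smul_eq_mul, mem_normAnnulus_iff, mem_normAnnulus_iff,
    Set.mem_sdiff, conv ν, conv J]
  constructor
  · rintro ⟨hν, hJ⟩
    have ht0 : t ≠ 0 := fun h => hJ (h ▸ zero_mem_primePowBall J)
    by_cases htN : t ∈ Set.range (normForm a)
    · exact Or.inl ⟨htN, hν, hJ⟩
    · exact Or.inr ⟨hidx t ht0 htN, hν, hJ⟩
  · rintro (⟨-, hν, hJ⟩ | ⟨-, hν, hJ⟩) <;> exact ⟨hν, hJ⟩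

/-- the two classes are disjoint (`ε ∉ H`, `H` a group). [cite: Weil1964, Chap. II n° 28, p. 176] -/
theorem disjoint_normAnnulus_smul {a ε : F} (hε : ε ∉ Set.range (normForm a)) (ν J ν' J' : ℤ) :
    Disjoint (normAnnulus a ν J) (ε • normAnnulus a ν' J') := by
  rw [Set.disjoint_left]
  intro t ht ht'
  obtain ⟨x, hx, rfl⟩ := Set.mem_smul_set.1 ht'
  rw [mem_normAnnulus_iff] at ht hx
  have hx0 : x ≠ 0 := fun h => hx.2.2 (h ▸ zero_mem_primePowBall J')
  apply hε
  rw [show ε = ε • x * x⁻¹ by rw [smul_eq_mul, mul_inv_cancel_right₀ hx0]]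
  exact mul_mem_range_normForm ht.1 (inv_mem_range_normForm hx.1)

end Annulus

/-! ## §5 The sign of `γ` on the non-trivial norm class -/

section Sign

variable [MeasurableSpace F] [BorelSpace F] (μ : Measure F) [μ.IsAddHaarMeasure] {ψ : AddChar F Circle}

/-- substitution `t = ε t'` on a set: `∫_{εT} f = ‖ε‖ ∫_T f(ε ·)`. [folklore] -/
private theorem setIntegral_smul_set_eq {ε : F} (hε : ε ≠ 0) {T : Set F} (hT : MeasurableSet T) (f : F → ℂ) :
    ∫ t in ε • T, f t ∂μ = ((normAbs F ε : ℝ) : ℂ) * ∫ t in T, f (ε * t) ∂μ := by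
  have hεT : MeasurableSet (ε • T) := hT.const_smul_of_ne_zero hε
  have hind : (fun x => (ε • T).indicator f (ε * x)) = T.indicator (fun x => f (ε * x)) := by
    funext x
    by_cases hx : x ∈ T
    · rw [Set.indicator_of_mem hx, Set.indicator_of_mem]
      exact (Set.smul_mem_smul_set_iff₀ hε T x).2 hx
    · rw [Set.indicator_of_notMem hx, Set.indicator_of_notMem]
      exact fun h => hx ((Set.smul_mem_smul_set_iff₀ hε T x).1 h)
  have h := integral_comp_mul_left μ hε ((ε • T).indicator f)
  rw [hind, integral_indicator hT, integral_indicator hεT, map_inv₀, Complex.real_smul, NNReal.coe_inv,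
    Complex.ofReal_inv] at h
  have hn : ((normAbs F ε : ℝ) : ℂ) ≠ 0 := by
    have : normAbs F ε ≠ 0 := (map_ne_zero (normAbs F)).2 hε
    exact_mod_cast this
  rw [h, ← mul_assoc, mul_inv_cancel₀ hn, one_mul]

omit [μ.IsAddHaarMeasure] in
/-- **small norm balls carry no oscillation**: for `v_b + J ≥ d`, `ψ(b N z) = 1` on `M_J`, so
`g(bN, M_J) = (μ × μ)(M_J)`. [cite: Weil1964, Chap. II n° 27, p. 174] -/
private theorem setIntegral_normBall_eq_measureReal {a b : F} {d vb J : ℤ} (hd : ψ.HasConductorExp d)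
    (hb : normAbs F b = (residueFieldCard F : ℝ≥0)⁻¹ ^ vb) (hJ : d ≤ vb + J) :
    ∫ z in normBall a J, psiSq₂ ψ b (-(a * b)) z ∂(μ.prod μ) = ((μ.prod μ).real (normBall a J) : ℂ) := by
  haveI : SecondCountableTopology F := secondCountable''
  have hmeas : MeasurableSet (normBall a J) := (isClosed_normBall a J).measurableSet
  have hbm : b ∈ primePowBall F vb := by rw [mem_primePowBall_iff, hb]
  have h1 : ∀ z ∈ normBall a J, psiSq₂ ψ b (-(a * b)) z = (1 : ℂ) := by
    intro z hz
    rw [psiSq₂_eq_normForm, hd.1 _ (primePowBall_antitone hJ (mul_mem_primePowBall hbm (mem_normBall.1 hz))),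
      Circle.coe_one]
  rw [setIntegral_congr_fun hmeas h1, setIntegral_const, Complex.real_smul, mul_one]

/-- Tate's orthogonality in the form used here: `∫_{𝔭^n} ψ(bt) dt = μ(𝔭^n)` if `v_b + n ≥ d`, else `0`.
[cite: Weil1964, Chap. II n° 27, p. 174] -/
private theorem setIntegral_primePowBall_addChar_mul' {d vb : ℤ} {b : F} (hd : ψ.HasConductorExp d)
    (hb : normAbs F b = (residueFieldCard F : ℝ≥0)⁻¹ ^ vb) (n : ℤ) :
    ∫ t in primePowBall F n, ((ψ (b * t) : Circle) : ℂ) ∂μ =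
      if d ≤ vb + n then (μ.real (primePowBall F n) : ℂ) else 0 := by
  have h := setIntegral_primePowBall_addChar_mul μ hd n b
  simp_rw [mul_comm _ b] at h
  rw [h]
  have hiff : b ∈ primePowBall F (d - n) ↔ d ≤ vb + n := by
    rw [mem_primePowBall_iff, hb, inv_residueFieldCard_zpow_le_iff]; omega
  by_cases hc : d ≤ vb + n
  · rw [if_pos (hiff.2 hc), if_pos hc]
  · rw [if_neg (fun h' => hc (hiff.1 h')), if_neg hc]

/-- E-side of Weil's computation: `g(cN, M_{ν'}) = κ_k ∫_{H_{ν',J'}} ψ(ct) dt + (μ × μ)(M_{J'})`.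
[cite: Weil1964, Chap. II n° 28, p. 176] -/
private theorem gaussBox_normBall_eq_fibre_add {a c : F} (ha : ¬ IsSquare a) {d vc k₀ k ν' J' : ℤ}
    (hd : ψ.HasConductorExp d) (hvc : normAbs F c = (residueFieldCard F : ℝ≥0)⁻¹ ^ vc)
    (hsq : ∀ h ∈ primePowBall F k₀, IsSquare (1 + h)) (hk₀ : k₀ ≤ k) (hk1 : 1 ≤ k) (hk' : d ≤ ν' + k + vc)
    (hJ'ν : ν' ≤ J') (hJ' : d ≤ vc + J') :
    gaussBox ψ μ c (-(a * c)) (normBall a ν') =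
      (fibreConst μ a k : ℂ) * ∫ t in normAnnulus a ν' J', ((ψ (c * t) : Circle) : ℂ) ∂μ +
        ((μ.prod μ).real (normBall a J') : ℂ) := by
  haveI : SecondCountableTopology F := secondCountable''
  haveI : T2Space F := t2''
  have hψc : Continuous ψ := continuous_of_hasConductorExp hd
  have hsub : normBall a J' ⊆ normBall a ν' := fun z hz =>
    mem_normBall.2 (primePowBall_antitone hJ'ν (mem_normBall.1 hz))
  have hmeasJ : MeasurableSet (normBall a J') := (isClosed_normBall a J').measurableSet
  have hfin : (μ.prod μ) (normBall a ν') ≠ ∞ := (isCompact_normBall ha ν').measure_lt_top.ne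
  rw [gaussBox_def, ← Set.sdiff_union_of_subset hsub, setIntegral_union Set.disjoint_sdiff_left hmeasJ
      ((integrableOn_psiSq₂' μ hψc c (-(a * c)) hfin).mono_set Set.sdiff_subset)
      ((integrableOn_psiSq₂' μ hψc c (-(a * c)) hfin).mono_set hsub),
    ← preimage_normAnnulus,
    setIntegral_preimage_normForm_eq_fibreConst_mul μ ha hd hvc hk1 hk' (isCompact_normAnnulus ha ν' J')
      (zero_not_mem_normAnnulus a ν' J') (normAnnulus_subset_range a ν' J') (normAnnulus_subset_primePowBall a ν' J')
      (fun t ht u hu => mul_mem_normAnnulus hsq hk₀ hk1 ht hu),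
    setIntegral_normBall_eq_measureReal μ hd hvc hJ']

/-- F-side of Weil's computation: `∫_{H_{ν,J}} ψ_b + ‖ε‖ ∫_{H_{ν-e,J-e}} ψ_{εb} = ∫_{𝔭^ν ∖ 𝔭^J} ψ_b = -μ(𝔭^J)`
for `ν < d - v_b ≤ J`. [cite: Weil1964, Chap. II n° 28, p. 176] -/
private theorem setIntegral_normAnnulus_add {a ε b : F} (ha : ¬ IsSquare a) {d vb e ν J : ℤ}
    (hd : ψ.HasConductorExp d) (hvb : normAbs F b = (residueFieldCard F : ℝ≥0)⁻¹ ^ vb)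
    (he : normAbs F ε = (residueFieldCard F : ℝ≥0)⁻¹ ^ e) (hε : ε ∉ Set.range (normForm a))
    (hidx : ∀ t : F, t ≠ 0 → t ∉ Set.range (normForm a) → ε⁻¹ * t ∈ Set.range (normForm a))
    (hν : ν ≤ d - vb - 1) (hJν : ν ≤ J) (hJ : d ≤ vb + J) :
    ∫ t in normAnnulus a ν J, ((ψ (b * t) : Circle) : ℂ) ∂μ +
      ((normAbs F ε : ℝ) : ℂ) * ∫ t in normAnnulus a (ν - e) (J - e), ((ψ (ε * b * t) : Circle) : ℂ) ∂μ =
      -(μ.real (primePowBall F J) : ℂ) := by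
  haveI : SecondCountableTopology F := secondCountable''
  haveI : T2Space F := t2''
  have hε0 : ε ≠ 0 := ne_zero_of_not_mem_range hε
  have hψc : Continuous ψ := continuous_of_hasConductorExp hd
  have hA' : MeasurableSet (normAnnulus a (ν - e) (J - e)) := (isCompact_normAnnulus ha _ _).measurableSet
  have hεA' : MeasurableSet (ε • normAnnulus a (ν - e) (J - e)) := hA'.const_smul_of_ne_zero hε0
  have hfinν : μ (primePowBall F ν) ≠ ∞ := (isCompact_primePowBall ν).measure_lt_top.ne
  have h0 : ∫ t in primePowBall F ν, ((ψ (b * t) : Circle) : ℂ) ∂μ = 0 := by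
    rw [setIntegral_primePowBall_addChar_mul' μ hd hvb, if_neg (by omega)]
  have hJint : ∫ t in primePowBall F J, ((ψ (b * t) : Circle) : ℂ) ∂μ = (μ.real (primePowBall F J) : ℂ) := by
    rw [setIntegral_primePowBall_addChar_mul' μ hd hvb, if_pos hJ]
  have hsubJ : primePowBall F J ⊆ primePowBall F ν := primePowBall_antitone hJν
  have hsubA : normAnnulus a ν J ⊆ primePowBall F ν := normAnnulus_subset_primePowBall a ν J
  have hsubA' : ε • normAnnulus a (ν - e) (J - e) ⊆ primePowBall F ν := by
    intro t ht
    obtain ⟨x, hx, rfl⟩ := Set.mem_smul_set.1 ht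
    rw [smul_eq_mul]
    exact (mul_mem_primePowBall_iff he).2 ((mem_normAnnulus_iff.1 hx).2.1)
  have hsplit := setIntegral_union (Set.disjoint_sdiff_left) (measurableSet_primePowBall J)
    ((integrableOn_addChar_mul μ hψc b hfinν).mono_set Set.sdiff_subset)
    ((integrableOn_addChar_mul μ hψc b hfinν).mono_set hsubJ)
  rw [Set.sdiff_union_of_subset hsubJ, h0, hJint, primePowBall_diff_eq_union he hidx ν J,
    setIntegral_union (disjoint_normAnnulus_smul hε ν J (ν - e) (J - e)) hεA'
      ((integrableOn_addChar_mul μ hψc b hfinν).mono_set hsubA) ((integrableOn_addChar_mul μ hψc b hfinν).mono_set hsubA'),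
    setIntegral_smul_set_eq μ hε0 hA'] at hsplit
  simp_rw [show ∀ t : F, b * (ε * t) = ε * b * t from fun t => by ring] at hsplit
  linear_combination -hsplit

/-- **THE SIGN OF THE GAUSS INTEGRALS ON THE NON-TRIVIAL NORM CLASS**: for `a` not a square, `H = N(F(√a)ˣ)`,
`ε ∉ H` such that every non-norm is `ε` times a norm, and `b ≠ 0`:
`g(b) g(-ab) = -‖ε‖ · g(εb) g(-aεb)`.
Proof (Weil, p. 176): `g(b)g(-ab) = ∫_{M_ν} ψ(bN) = κ ∫_{H ∩ (𝔭^ν∖𝔭^J)} ψ_b + (μ×μ)(M_J)`, the same for `εb` on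
`M_{ν-e}`, and `0 = ∫_{𝔭^ν} ψ_b = ∫_{H∩…} ψ_b + ‖ε‖ ∫_{H∩…} ψ_{εb} + μ(𝔭^J)`; the resulting identity
`g(b)g(-ab) + ‖ε‖ g(εb)g(-aεb) = -κ μ(𝔭^J) + (μ×μ)(M_J) + ‖ε‖ (μ×μ)(M_{J-e})` is multiplied by `q⁻²` on the right
under `J ↦ J + 2`, so both sides vanish. Hypotheses `hsq` (local square theorem) and `hidx` (`[Fˣ : H] ≤ 2`) hold
in every non-archimedean local field. [cite: Weil1964, Chap. II n° 28, Prop. 4, p. 176] -/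
theorem weilGauss_mul_weilGauss_nonNorm (hψ : ψ.IsContinuousNontrivial) {a ε b : F} (ha : ¬ IsSquare a)
    (hb : b ≠ 0) (htwo : (2 : F) ≠ 0) {k₀ : ℤ} (hsq : ∀ h ∈ primePowBall F k₀, IsSquare (1 + h))
    (hε : ε ∉ Set.range (normForm a))
    (hidx : ∀ t : F, t ≠ 0 → t ∉ Set.range (normForm a) → ε⁻¹ * t ∈ Set.range (normForm a)) :
    weilGauss ψ μ b * weilGauss ψ μ (-(a * b)) =
      -(((normAbs F ε : ℝ) : ℂ) * (weilGauss ψ μ (ε * b) * weilGauss ψ μ (-(a * (ε * b))))) := by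
  have hε0 : ε ≠ 0 := ne_zero_of_not_mem_range hε
  have hεb : ε * b ≠ 0 := mul_ne_zero hε0 hb
  have hq0 : (residueFieldCard F : ℝ≥0)⁻¹ ≠ 0 := inv_residueFieldCard_pos.ne'
  obtain ⟨d, vb, _, hd, hvb, -⟩ := exists_exponents hψ hb htwo
  obtain ⟨e, he⟩ := exists_normAbs_eq_inv_zpow hε0
  have hvεb : normAbs F (ε * b) = (residueFieldCard F : ℝ≥0)⁻¹ ^ (e + vb) := by
    rw [map_mul, he, hvb, zpow_add₀ hq0]
  obtain ⟨ν₀, hν₀⟩ := exists_forall_gaussBox_normBall_eq μ hψ ha hb htwo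
  obtain ⟨ν₀', hν₀'⟩ := exists_forall_gaussBox_normBall_eq μ hψ ha hεb htwo
  -- the parameters `ν` (a large norm ball) and `k` (a fine unit group)
  obtain ⟨ν, hν₁, hν₂, hν₃⟩ : ∃ ν : ℤ, ν ≤ ν₀ ∧ ν - e ≤ ν₀' ∧ ν ≤ d - vb - 1 :=
    ⟨min (min ν₀ (ν₀' + e)) (d - vb - 1), by omega, by omega, by omega⟩
  obtain ⟨k, hk₀, hk1, hkν⟩ : ∃ k : ℤ, k₀ ≤ k ∧ 1 ≤ k ∧ d - vb - ν ≤ k :=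
    ⟨max (max k₀ 1) (d - vb - ν), by omega, by omega, by omega⟩
  -- the key identity, for every `J ≥ d - v_b`
  have key : ∀ {J : ℤ}, d - vb ≤ J →
      weilGauss ψ μ b * weilGauss ψ μ (-(a * b)) +
          ((normAbs F ε : ℝ) : ℂ) * (weilGauss ψ μ (ε * b) * weilGauss ψ μ (-(a * (ε * b)))) =
        ((-fibreConst μ a k * μ.real (primePowBall F J) + (μ.prod μ).real (normBall a J) +
            (normAbs F ε : ℝ) * (μ.prod μ).real (normBall a (J - e)) : ℝ) : ℂ) := by
    intro J hJ
    have h1 : weilGauss ψ μ b * weilGauss ψ μ (-(a * b)) =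
        (fibreConst μ a k : ℂ) * ∫ t in normAnnulus a ν J, ((ψ (b * t) : Circle) : ℂ) ∂μ +
          ((μ.prod μ).real (normBall a J) : ℂ) := by
      rw [← hν₀ ν hν₁]
      exact gaussBox_normBall_eq_fibre_add μ ha hd hvb hsq hk₀ hk1 (by omega) (by omega) (by omega)
    have h2 : weilGauss ψ μ (ε * b) * weilGauss ψ μ (-(a * (ε * b))) =
        (fibreConst μ a k : ℂ) * ∫ t in normAnnulus a (ν - e) (J - e), ((ψ (ε * b * t) : Circle) : ℂ) ∂μ +
          ((μ.prod μ).real (normBall a (J - e)) : ℂ) := by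
      rw [← hν₀' (ν - e) hν₂]
      exact gaussBox_normBall_eq_fibre_add μ ha hd hvεb hsq hk₀ hk1 (by omega) (by omega) (by omega)
    have h3 := setIntegral_normAnnulus_add μ ha hd hvb he hε hidx (J := J) hν₃ (by omega) (by omega)
    rw [h1, h2]
    push_cast
    linear_combination (fibreConst μ a k : ℂ) * h3
  -- homothety by (the square of) a uniformiser: the right side scales by `q⁻²` under `J ↦ J + 2`
  obtain ⟨ϖ, hϖ0, hϖ⟩ := exists_normAbs_eq_inv_zpow_of_int (F := F) 1
  have hϖ2 : normAbs F (ϖ ^ 2) = (residueFieldCard F : ℝ≥0)⁻¹ ^ (2 : ℤ) := by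
    rw [map_pow, hϖ, zpow_one, zpow_two, pow_two]
  have hq : (residueFieldCard F : ℝ) ≠ 0 := Nat.cast_ne_zero.2 (residueFieldCard_ne_zero F)
  have hr : ((normAbs F (ϖ ^ 2) : ℝ≥0) : ℝ) = ((residueFieldCard F : ℝ)⁻¹) ^ 2 := by
    rw [hϖ2]; push_cast; rw [zpow_two, pow_two]
  have hP : μ.real (primePowBall F (d - vb + 2)) =
      ((residueFieldCard F : ℝ)⁻¹) ^ 2 * μ.real (primePowBall F (d - vb)) := by
    rw [LocalFieldHaar.measureReal_primePowBall μ (d - vb + 2), LocalFieldHaar.measureReal_primePowBall μ (d - vb),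
      zpow_add₀ (inv_ne_zero hq), zpow_two, pow_two]
    ring
  have hM : ∀ J : ℤ, (μ.prod μ).real (normBall a (J + 2)) =
      ((residueFieldCard F : ℝ)⁻¹) ^ 2 * (μ.prod μ).real (normBall a J) := by
    intro J
    have e1 : normBall a (J + 2) = normForm a ⁻¹' (ϖ ^ 2 • primePowBall F J) := Set.ext fun z => by
      rw [Set.mem_preimage, mem_normBall, LocalFieldHaar.smul_primePowBall hϖ2 J]
    have e2 : normBall a J = normForm a ⁻¹' primePowBall F J := rfl
    rw [e1, e2, measureReal_def, measureReal_def,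
      measure_preimage_normForm_sq_smul μ a hϖ0 (measurableSet_primePowBall J), ENNReal.toReal_mul,
      ENNReal.coe_toReal, hr]
  have hr1 : ((residueFieldCard F : ℝ)⁻¹) ^ 2 ≠ 1 := by
    have hlt : (residueFieldCard F : ℝ)⁻¹ < 1 := by
      have := inv_residueFieldCard_lt_one (F := F)
      exact_mod_cast this
    exact (pow_lt_one₀ (inv_nonneg.2 (Nat.cast_nonneg _)) hlt two_ne_zero).ne
  have h1 := key (J := d - vb) le_rfl
  have h2 := key (J := d - vb + 2) (by omega)
  rw [show d - vb + 2 - e = (d - vb - e) + 2 by ring, hM, hM, hP] at h2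
  have h12 := Complex.ofReal_injective (h1.symm.trans h2)
  have hR : (-fibreConst μ a k * μ.real (primePowBall F (d - vb)) + (μ.prod μ).real (normBall a (d - vb)) +
      (normAbs F ε : ℝ) * (μ.prod μ).real (normBall a (d - vb - e))) = 0 := by
    have hm : (1 - ((residueFieldCard F : ℝ)⁻¹) ^ 2) *
        (-fibreConst μ a k * μ.real (primePowBall F (d - vb)) + (μ.prod μ).real (normBall a (d - vb)) +
          (normAbs F ε : ℝ) * (μ.prod μ).real (normBall a (d - vb - e))) = 0 := by
      linear_combination h12
    exact (mul_eq_zero.1 hm).resolve_left (sub_ne_zero.2 hr1.symm)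
  rw [hR, Complex.ofReal_zero] at h1
  exact eq_neg_of_add_eq_zero_left h1

/-- phases of complex numbers differing by a negative real factor are opposite. [folklore] -/
private theorem div_norm_eq_neg_of_eq_neg_mul {z w : ℂ} {r : ℝ} (hr : 0 < r) (h : z = -((r : ℂ) * w)) :
    z / (‖z‖ : ℂ) = -(w / (‖w‖ : ℂ)) := by
  have hr' : ((r : ℝ) : ℂ) ≠ 0 := Complex.ofReal_ne_zero.2 hr.ne'
  rw [h, norm_neg, norm_mul, Complex.norm_real, Real.norm_of_nonneg hr.le, Complex.ofReal_mul, neg_div,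
    mul_div_mul_left _ _ hr']

/-- **THE SIGN OF THE WEIL INDEX ON THE NON-TRIVIAL NORM CLASS**: `γ(εb) γ(-aεb) = -γ(b) γ(-ab)` for
`ε ∉ H = N(F(√a)ˣ)` — the `(a, ε) = -1` counterpart of the norm-class invariance
`LocalBinaryNormFormIndex.weilIndex_mul_weilIndex_normClass`. [cite: Weil1964, Chap. II n° 28, Prop. 4, p. 176] -/
theorem weilIndex_mul_weilIndex_nonNorm (hψ : ψ.IsContinuousNontrivial) {a ε b : F} (ha : ¬ IsSquare a)
    (hb : b ≠ 0) (htwo : (2 : F) ≠ 0) {k₀ : ℤ} (hsq : ∀ h ∈ primePowBall F k₀, IsSquare (1 + h))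
    (hε : ε ∉ Set.range (normForm a))
    (hidx : ∀ t : F, t ≠ 0 → t ∉ Set.range (normForm a) → ε⁻¹ * t ∈ Set.range (normForm a)) :
    weilIndex ψ μ (ε * b) * weilIndex ψ μ (-(a * (ε * b))) = -(weilIndex ψ μ b * weilIndex ψ μ (-(a * b))) := by
  have h := weilGauss_mul_weilGauss_nonNorm μ hψ ha hb htwo hsq hε hidx
  have hn : (0 : ℝ) < (normAbs F ε : ℝ) := by
    have : normAbs F ε ≠ 0 := (map_ne_zero (normAbs F)).2 (ne_zero_of_not_mem_range hε)
    exact_mod_cast pos_iff_ne_zero.2 this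
  rw [weilIndex_mul_weilIndex, weilIndex_mul_weilIndex, div_norm_eq_neg_of_eq_neg_mul hn h, neg_neg]

/-- **`(a, b)_F = -1 ⟹ γ(b) γ(-ab) = -γ(1) γ(-a)`** — the half of Weil's Hilbert-symbol law complementary to
`LocalBinaryNormFormIndex.weilIndex_mul_weilIndex_eq_of_hilbertSymbol_eq_one`.
[cite: Weil1964, Chap. II n° 28, Prop. 4 and (28), pp. 176–177] -/
theorem weilIndex_mul_weilIndex_eq_neg_of_hilbertSymbol_eq_neg_one (hψ : ψ.IsContinuousNontrivial) {a b : F}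
    (ha : ¬ IsSquare a) (hb : b ≠ 0) (htwo : (2 : F) ≠ 0) {k₀ : ℤ}
    (hsq : ∀ h ∈ primePowBall F k₀, IsSquare (1 + h))
    (hidx : ∀ t : F, t ≠ 0 → t ∉ Set.range (normForm a) → b⁻¹ * t ∈ Set.range (normForm a))
    (h : QuadraticForms.hilbertSymbol F a b = -1) :
    weilIndex ψ μ b * weilIndex ψ μ (-(a * b)) = -(weilIndex ψ μ 1 * weilIndex ψ μ (-a)) := by
  have hbN := not_mem_range_normForm_of_hilbertSymbol_eq_neg_one ha hb htwo h
  have := weilIndex_mul_weilIndex_nonNorm μ hψ ha one_ne_zero htwo hsq hbN hidx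
  simpa only [mul_one] using this

/-- **WEIL'S HILBERT-SYMBOL LAW, binary form of (28)**: for `a` not a square and `b ≠ 0`,
`γ(b) γ(-ab) = (a, b)_F · γ(1) γ(-a)`, equivalently `γ(1)γ(-a)γ(-b)γ(ab) = (a,-b)(γ(1)γ(-a))² = (a, b)_F`
(Weil: `γ` of the norm form `x² - ay² - bz² + abt²` of the quaternion algebra `(a, b)` is its Hasse invariant),
under the local square theorem `hsq` and `[Fˣ : N(F(√a)ˣ)] ≤ 2` (`hidx`), both valid in every
non-archimedean local field. [cite: Weil1964, Chap. II n° 28, (28), p. 176] -/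
theorem weilIndex_mul_weilIndex_eq_hilbertSymbol_mul (hψ : ψ.IsContinuousNontrivial) {a b : F}
    (ha : ¬ IsSquare a) (hb : b ≠ 0) (htwo : (2 : F) ≠ 0) {k₀ : ℤ}
    (hsq : ∀ h ∈ primePowBall F k₀, IsSquare (1 + h))
    (hidx : ∀ t : F, t ≠ 0 → t ∉ Set.range (normForm a) → b⁻¹ * t ∈ Set.range (normForm a)) :
    weilIndex ψ μ b * weilIndex ψ μ (-(a * b)) =
      (QuadraticForms.hilbertSymbol F a b : ℂ) * (weilIndex ψ μ 1 * weilIndex ψ μ (-a)) := by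
  have ha0 : a ≠ 0 := fun h0 => ha (h0 ▸ IsSquare.zero)
  rcases QuadraticForms.hilbertSymbol_eq_one_or_eq_neg_one a b with h | h
  · rw [h, weilIndex_mul_weilIndex_eq_of_hilbertSymbol_eq_one μ hψ ha0 hb htwo h]; push_cast; ring
  · rw [h, weilIndex_mul_weilIndex_eq_neg_of_hilbertSymbol_eq_neg_one μ hψ ha hb htwo hsq hidx h]; push_cast; ring

/-- the same law for `a` a non-zero square (then `(a, b)_F = 1` and no hypothesis is needed).
[cite: Weil1964, Chap. II n° 28, (28), p. 176] -/
theorem weilIndex_mul_weilIndex_eq_hilbertSymbol_mul_of_isSquare (hψ : ψ.IsContinuousNontrivial) {a b : F}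
    (ha : IsSquare a) (ha0 : a ≠ 0) (hb : b ≠ 0) (htwo : (2 : F) ≠ 0) :
    weilIndex ψ μ b * weilIndex ψ μ (-(a * b)) =
      (QuadraticForms.hilbertSymbol F a b : ℂ) * (weilIndex ψ μ 1 * weilIndex ψ μ (-a)) := by
  have h1 := QuadraticForms.hilbertSymbol_eq_one_of_isSquare ha ha0 b
  rw [h1, weilIndex_mul_weilIndex_eq_of_hilbertSymbol_eq_one μ hψ ha0 hb htwo h1]; push_cast; ring

end Sign

end Literature.NumberTheory.Weil1964
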